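import Summits.CriticalPhenomena.Ising3D.TaylorCertificateTermwise
import Mathlib.Tactic.Linarith
import Mathlib.Tactic.Positivity
import Mathlib.Tactic.Ring
import HarnessLib

/-!
# The even-sector TAIL of a derivative certificate from a region inequality on the cone `E ≥ E₀, j ≤ E`
(cell `pub-ising3x`, seat boot-1; gate (g2), even sector: the typed form of GAMMA-LEMMAS §1
"MixedEvenRegionCheck ⇒ tail_evenPositive" for DERIVATIVE functionals)

HONEST FRAMING: lottery ticket; floor = tightest certified 3D Ising CFT bounds; no exact-solution
claim without a proof.

In the even sector the `z`-series coefficients `A_{n,j}/λ_ℓ ≥ 0` factor out of the termwise rule, so the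
(E5) obligation `tail_even` of `MixedObligations` (every even `ℓ`, every `Δ ≥ max(E₀, bound)`) follows from
ONE coefficient-free statement about the functional on the cone of term labels:
`TaylorEvenRegion α Q E₀` — for all `(Δσ,Δε) ∈ Q`, all real `E ≥ E₀` and all `j ≤ E`, the three closed-form
numbers `X = α¹[F^{Δσ}_-[𝒫_{E,j}]]`, `Y = α²[F^{Δε}_-[𝒫_{E,j}]]`, `Z = α⁴[F^s_-[𝒫_{E,j}]] + α⁵[F^s_+[𝒫_{E,j}]]`
satisfy `X, Y ≥ 0`, `Z² ≤ 4XY` (`tail_even_of_taylorEvenRegion`). By (g0′) `taylorCoeffAt_crossF_zMono` the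
three numbers are finite binomial-coefficient expressions, at `x = ½` polynomial in `(E, j)` times
`2^{-E}`-type prefactors: a certificate discharges the region by a box partition + an asymptotic cone
argument exactly as pub-ising3d's verify_A §region did for one correlator (1 041 boxes at Λ = 11).
The odd tail has NO coefficient-free analogue (the signed `A(-t/2,t/2)` does not factor out): that is (g1).
Sources: Kos–Poland–Simmons-Duffin 2014 §3.3; Hogervorst–Rychkov 2013 §3 eq. (3.9).
-/

namespace Summit.CriticalPhenomena.Ising3D

open Finset Set
open Literature.MathematicalPhysics.QuantumFieldTheory.ConformalBootstrap3D

/-- **The even-sector region predicate of a derivative certificate** on the cone `E ≥ E₀`, `j ≤ E`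
(coefficient-free; three closed-form numbers per `(E, j)` and `(Δσ, Δε) ∈ Q`).
[cite: KosPolandSimmonsduffin2014, §3.3 eq. (3.16)] -/
def TaylorEvenRegion (α : CrossingFunctional) (Q : Set (ℝ × ℝ)) (E₀ : ℝ) : Prop :=
  ∀ p ∈ Q, ∀ (E : ℝ) (j : ℕ), E₀ ≤ E → (j : ℝ) ≤ E →
    0 ≤ α.α₁ (crossF p.1 (-1) (zMono E j)) ∧ 0 ≤ α.α₂ (crossF p.2 (-1) (zMono E j)) ∧
      (α.α₄ (crossF ((p.1 + p.2) / 2) (-1) (zMono E j)) +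
          α.α₅ (crossF ((p.1 + p.2) / 2) 1 (zMono E j))) ^ 2 ≤
        4 * α.α₁ (crossF p.1 (-1) (zMono E j)) * α.α₂ (crossF p.2 (-1) (zMono E j))

/-- **(E5) from the region**: for a crossing functional Taylor at a diagonal point `(x,x)` and a head
threshold `E₀ > 1/2`, `TaylorEvenRegion α Q E₀` gives the even-sector tail obligation of
`MixedObligations` — every even spin `ℓ`, every `Δ ≥ unitarityBound3D ℓ` with `Δ ≥ E₀` (conserved currents
and accidental degeneracies included). [cite: KosPolandSimmonsduffin2014, §3.3 eq. (3.16)] -/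
theorem tail_even_of_taylorEvenRegion {x : ℝ} (hx0 : 0 < x) (hx1 : x < 1) (α : CrossingFunctional)
    (hα : IsTaylorAt α x x) {Q : Set (ℝ × ℝ)} {E₀ : ℝ} (hE₀ : 1 / 2 < E₀)
    (hR : TaylorEvenRegion α Q E₀) :
    ∀ p ∈ Q, ∀ ℓ : ℕ, Even ℓ → ∀ Δ : ℝ, unitarityBound3D ℓ ≤ Δ → E₀ ≤ Δ →
      α.EvenPositive p.1 p.2 Δ ℓ := by
  intro p hp ℓ _ Δ hb hE
  have hadm : IsAdmissible3D Δ ℓ := by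
    refine ⟨hb, fun hℓ => ?_⟩
    subst hℓ
    have : unitarityBound3D 0 = 1 / 2 := by simp [unitarityBound3D]
    rw [this]
    linarith
  have hℓΔ : (ℓ : ℝ) ≤ Δ := (natCast_le_unitarityBound3D ℓ).trans hb
  refine evenPositive_of_isTaylorAt_of_forall hx0 hx1 α hα hadm fun q hq a b => ?_
  have hE' : E₀ ≤ Δ + (q.1 : ℝ) := by
    have : (0 : ℝ) ≤ q.1 := Nat.cast_nonneg _
    linarith
  have hj : (q.2 : ℝ) ≤ Δ + (q.1 : ℝ) := by
    have h2 : q.2 ≤ ℓ + q.1 := hq.2.1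
    have : (q.2 : ℝ) ≤ ℓ + q.1 := by exact_mod_cast h2
    linarith
  obtain ⟨hX, hY, hZ⟩ := hR p hp (Δ + (q.1 : ℝ)) q.2 hE' hj
  exact α.evenForm_nonneg_of_det p.1 p.2 _ hX hY hZ a b

end Summit.CriticalPhenomena.Ising3D
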